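import Mathlib
import Literature.Analysis.FluidPDE.TaoLocalisation
import Summits.NavierStokesRegularity.NavierStokesRegularity.Theorems.RootDecompLitSlicePressureFluxSlice
import HarnessLib

/-!
# Route RootDecompLitSlice — cell Uᶜ `CritTameScarIsCritical` (stmt-NavierStokesRegularity-31733):
# the PRESSURE FLUX BUDGET on a terminal window from the GLOBAL (Stein) pressure bound

Helpers toward the Tao-vacuous cell Uᶜ (`--supports 31733`; no item, no node, no registered stub).
Sequel of `RootDecompLitSlicePressureFluxSlice.lean` (slice bound `PressureFlux.slice_le`,
integrability `PressureFlux.integrable_slab`, `PressureFlux.young_optimise`). The assembled scar law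
`LocalEnergyBudget.scar_le_of_pressureBudget` (landed) carries the pressure flux
`mpu ≥ ∬_{(T−τ,t₁)×B_R}|p − c(t)||u|` as its last hypothesis number; here it is discharged CRUDELY,
by the whole-space `L^{3/2}` bound of the associated pressure (no local pressure decomposition):

* ★ `PressureFlux.pressureFlux_le_young` — with the gauge data of
  `PressureGauge.exists_gauge_associated_pressure` (`p − c(t) = p̃` a.e., `‖p̃(t)‖_{3/2} ≤
  C_{3/2}‖u(t)‖₃²`), `|p − c(t)||u|` is integrable on every sub-box `(T−τ,t₁) × B(x₀,R)` and
  `∬|p − c||u| ≤ C_{3/2} K^{3/2} √(∫|u₀|²) a^{1/4} (¾κG + ¼κ⁻³τ)` for every `κ > 0` (Fubini, the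
  slice bound with `∫⁻‖u(t)‖ₑ² ≤ ∫|u₀|²` — tree `IsLerayHopfOn.lintegral_enorm_sq_le` — and Young
  in time; `a` = local energy on the window, `G` = window enstrophy);
* ★★ `PressureFlux.pressureFlux_le` — the optimised form
  `∬|p − c||u| ≤ C_{3/2} K^{3/2} ‖u₀‖₂ a^{1/4} τ^{1/4} G^{3/4}`: the cubic-flux budget
  `K^{3/2} a^{3/4} τ^{1/4} G^{3/4}` of the landed `CubicFlux.cubicFlux_le` with `a^{3/4}` replaced by
  `C_{3/2}‖u₀‖₂ a^{1/4}`.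

HONEST FRAMING: helper lemmas INSIDE the Tao-vacuous cell Uᶜ; zero load of the route moves
(ROOT ⟺ U ∧ P1, critic rows 354/371/563/639/665/678); no item is re-typed. Rung 0: nothing here
proves NS regularity. The bound is the CRUDE (global) pressure tier: it feeds the exponent
bookkeeping of the clock → scar law but cannot reach the endpoint clock `b = 1/2`.
Decomp-ns route-writer g40. [cite: CaffarelliKohnNirenberg1982, §2 (2.4)] [cite: Evans2010, §5.6.1 Thm. 1–2]
-/

set_option linter.dupNamespace false

noncomputable section

namespace Summit.NavierStokesRegularity.NavierStokesRegularity.Theorems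

open MeasureTheory TopologicalSpace Set Function Filter Metric
open _root_.Topology
open scoped InnerProductSpace RealInnerProductSpace ENNReal NNReal ContDiff
open Literature.Analysis.FluidPDE

namespace PressureFlux

/-- ★ **THE PRESSURE FLUX BUDGET, Young form.** Frame: `ν ≥ 0`, classical on `[0,T) × ℝ³`,
Leray–Hopf on `[0,T]` from `u 0`; a window `(T − τ, T)`, a sub-window end `t₁ < T`, a local energy
bound `∫_{B(x₀,R)}|u(s)|² ≤ a` on `[T − τ, T)`, a window enstrophy bound `∫_{T−τ}^{T}∫|∇u|²_F ≤ G`;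
GAUGE DATA: `p̃ ∈ L^{3/2}` of the slab with `p − c(t) = p̃` a.e. on `(0,T) × ℝ³` and for a.e. `t`
the slice `p̃(t) ∈ L^{3/2}` with `‖p̃(t)‖_{3/2} ≤ C_{3/2}‖u(t)‖₃²` (all supplied by
`PressureGauge.exists_gauge_associated_pressure`). Then `|p − c(t)||u|` is integrable on
`(T−τ,t₁) × B(x₀,R)` and for every `κ > 0`
`∬_{(T−τ,t₁)×B(x₀,R)}|p − c(t)||u| ≤ C_{3/2} K^{3/2} √(∫|u₀|²) a^{1/4} (¾ κ G + ¼ κ⁻³ τ)`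
(Fubini, `slice_le` with `∫⁻‖u(t)‖ₑ² ≤ ∫|u₀|²` — tree `IsLerayHopfOn.lintegral_enorm_sq_le` —
and Young `F^{3/4} ≤ ¾κF + ¼κ⁻³` in time). [cite: CaffarelliKohnNirenberg1982, §2 (2.4)] -/
theorem pressureFlux_le_young {ν T : ℝ} (hν : 0 ≤ ν)
    {u : ℝ → EuclideanSpace ℝ (Fin 3) → EuclideanSpace ℝ (Fin 3)}
    {p : ℝ → EuclideanSpace ℝ (Fin 3) → ℝ}
    (hcl : IsClassicalNSSolutionOn (Set.Ico 0 T) ν 0 u p) (hLH : IsLerayHopfOn T ν 0 (u 0) u)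
    (x₀ : EuclideanSpace ℝ (Fin 3)) (R : ℝ) {τ t₁ a G κ : ℝ} (hτT : τ < T)
    (ht₁ : t₁ ∈ Ioo (T - τ) T)
    (ha : ∀ s ∈ Ico (T - τ) T, ∫ x in ball x₀ R, ‖u s x‖ ^ 2 ≤ a) (hG : 0 ≤ G)
    (hGw : ∫⁻ t in Ioo (T - τ) T, ∫⁻ x, ENNReal.ofReal (frobeniusNormSq (fderiv ℝ (u t) x)) ≤
      ENNReal.ofReal G)
    (hκ : 0 < κ)
    {q : ℝ → EuclideanSpace ℝ (Fin 3) → ℝ} {c : ℝ → ℝ}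
    (hq32 : MemLp (uncurry q) (3 / 2 : ℝ≥0∞)
      (volume.restrict (Ioo 0 T ×ˢ (univ : Set (EuclideanSpace ℝ (Fin 3))))))
    (hpq : ∀ᵐ z ∂(volume.restrict (Ioo 0 T ×ˢ (univ : Set (EuclideanSpace ℝ (Fin 3))))),
      p z.1 z.2 - c z.1 = q z.1 z.2)
    (hsl : ∀ᵐ t ∂(volume.restrict (Ioo 0 T)),
      (∀ᵐ x ∂(volume : Measure (EuclideanSpace ℝ (Fin 3))), p t x - c t = q t x) ∧
        MemLp (q t) (3 / 2 : ℝ≥0∞) volume ∧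
        eLpNorm (q t) (3 / 2 : ℝ≥0∞) volume ≤ steinConstThreeHalves * eLpNorm (u t) 3 volume ^ 2) :
    IntegrableOn (fun z : ℝ × EuclideanSpace ℝ (Fin 3) => |p z.1 z.2 - c z.1| * ‖u z.1 z.2‖)
        (Ioo (T - τ) t₁ ×ˢ ball x₀ R) ∧
      ∫ z in Ioo (T - τ) t₁ ×ˢ ball x₀ R, |p z.1 z.2 - c z.1| * ‖u z.1 z.2‖ ≤
        (steinConstThreeHalves : ℝ) *
          ((SNormLESNormFDerivOfEqConst (EuclideanSpace ℝ (Fin 3))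
            (volume : Measure (EuclideanSpace ℝ (Fin 3))) 2 : ℝ≥0) : ℝ) ^ (3 / 2 : ℝ) *
          Real.sqrt (∫ x, ‖u 0 x‖ ^ 2) * a ^ (1 / 4 : ℝ) *
            (3 / 4 * κ * G + 4⁻¹ * κ⁻¹ ^ 3 * τ) := by
  set K : ℝ≥0 := SNormLESNormFDerivOfEqConst (EuclideanSpace ℝ (Fin 3))
    (volume : Measure (EuclideanSpace ℝ (Fin 3))) 2 with hK
  set CS : ℝ≥0 := steinConstThreeHalves with hCS
  set F : ℝ → ℝ≥0∞ := fun t => ∫⁻ x, ENNReal.ofReal (frobeniusNormSq (fderiv ℝ (u t) x)) with hF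
  set E : ℝ := ∫ x, ‖u 0 x‖ ^ 2 with hEdef
  have hE0 : 0 ≤ E := integral_nonneg fun x => by positivity
  have hτ : 0 < τ := by linarith [ht₁.1, ht₁.2]
  have h0 : 0 < T - τ := sub_pos.2 hτT
  have ha0 : 0 ≤ a :=
    (integral_nonneg fun x => by positivity).trans (ha (T - τ) ⟨le_rfl, by linarith⟩)
  set I : Set ℝ := Ioo (T - τ) t₁ with hIdef
  set B : Set (EuclideanSpace ℝ (Fin 3)) := ball x₀ R with hBdef
  have hI0T : I ⊆ Ioo 0 T := Ioo_subset_Ioo h0.le ht₁.2.le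
  have hIB : I ×ˢ B ⊆ Ioo 0 T ×ˢ (univ : Set (EuclideanSpace ℝ (Fin 3))) :=
    prod_mono hI0T (subset_univ _)
  have hprod : (volume : Measure (ℝ × EuclideanSpace ℝ (Fin 3))).restrict (I ×ˢ B) =
      (volume.restrict I).prod (volume.restrict B) := by
    rw [Measure.volume_eq_prod, Measure.prod_restrict]
  -- the integrable majorant `‖q‖‖u‖` and the a.e. identity on the box
  set g : ℝ × EuclideanSpace ℝ (Fin 3) → ℝ := fun z => ‖q z.1 z.2‖ * ‖u z.1 z.2‖ with hgdef
  have hgS := integrable_slab hLH hq32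
  have hgIB : Integrable g ((volume.restrict I).prod (volume.restrict B)) := by
    rw [← hprod]; exact hgS.mono_measure (Measure.restrict_mono hIB le_rfl)
  have hae : (fun z : ℝ × EuclideanSpace ℝ (Fin 3) => |p z.1 z.2 - c z.1| * ‖u z.1 z.2‖)
      =ᵐ[volume.restrict (I ×ˢ B)] g := by
    filter_upwards [ae_restrict_of_ae_restrict_of_subset hIB hpq] with z hz
    show |p z.1 z.2 - c z.1| * ‖u z.1 z.2‖ = ‖q z.1 z.2‖ * ‖u z.1 z.2‖
    rw [hz, Real.norm_eq_abs]
  have hint : IntegrableOn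
      (fun z : ℝ × EuclideanSpace ℝ (Fin 3) => |p z.1 z.2 - c z.1| * ‖u z.1 z.2‖) (I ×ˢ B) := by
    have hg' : Integrable g (volume.restrict (I ×ˢ B)) := by rw [hprod]; exact hgIB
    exact hg'.congr hae.symm
  refine ⟨hint, ?_⟩
  -- Fubini
  set cq : ℝ → ℝ := fun s => ∫ x in B, g (s, x) with hcq
  have hcqI : Integrable cq (volume.restrict I) := hgIB.integral_prod_left
  have hcqnn : ∀ s, 0 ≤ cq s := fun s => integral_nonneg fun x => by
    simp only [hgdef]; positivity
  have heq : ∫ z in I ×ˢ B, |p z.1 z.2 - c z.1| * ‖u z.1 z.2‖ = ∫ s in I, cq s := by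
    rw [integral_congr_ae hae,
      show (∫ z in I ×ˢ B, g z) = ∫ z, g z ∂((volume.restrict I).prod (volume.restrict B)) by
        rw [← hprod]]
    exact integral_prod _ hgIB
  -- the slice bound, a.e. on `I`, in `ℝ≥0∞`
  set Mₑ : ℝ≥0∞ := (CS : ℝ≥0∞) * ENNReal.ofReal E ^ (1 / 2 : ℝ) * ENNReal.ofReal a ^ (4⁻¹ : ℝ) *
    ((K : ℝ≥0∞) ^ (3 / 2 : ℝ)) with hMₑ
  have hslice : ∀ᵐ s ∂(volume.restrict I), ENNReal.ofReal (cq s) ≤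
      Mₑ * (ENNReal.ofReal (3 / 4 * κ) * F s + ENNReal.ofReal (4⁻¹ * κ⁻¹ ^ 3)) := by
    have h1 : ∀ᵐ s ∂(volume.restrict I), Integrable (fun x => g (s, x)) (volume.restrict B) :=
      hgIB.prod_right_ae
    filter_upwards [ae_restrict_mem measurableSet_Ioo, h1,
      ae_restrict_of_ae_restrict_of_subset hI0T hsl] with s hs hgs hst
    have hsS : s ∈ Set.Ico 0 T := ⟨(hI0T hs).1.le, (hI0T hs).2⟩
    have hC1 : ContDiff ℝ 1 (u s) := (hcl.contDiff_velocity hsS).of_le (by norm_cast)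
    have hmem : MemLp (u s) 2 volume := hLH.memLp s ⟨hsS.1, hsS.2.le⟩
    have hcont : Continuous (u s) := hC1.continuous
    -- `ofReal (cq s) = ∫⁻_B ‖q s‖ₑ ‖u s‖ₑ`
    have e1 : ENNReal.ofReal (cq s) = ∫⁻ x in B, ‖q s x‖ₑ * ‖u s x‖ₑ := by
      rw [hcq, ofReal_integral_eq_lintegral_ofReal hgs (ae_of_all _ fun x => by
        simp only [hgdef]; positivity)]
      refine lintegral_congr fun x => ?_
      simp only [hgdef]
      rw [ENNReal.ofReal_mul (norm_nonneg _), ofReal_norm, ofReal_norm]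
    -- local energy and global energy of the slice
    have hintB : IntegrableOn (fun x => ‖u s x‖ ^ 2) B volume :=
      ((hcont.norm.pow 2).continuousOn.integrableOn_compact
        (isCompact_closedBall x₀ R)).mono_set ball_subset_closedBall
    have e2 : ∫⁻ x in B, ‖u s x‖ₑ ^ 2 = ENNReal.ofReal (∫ x in B, ‖u s x‖ ^ 2) := by
      rw [ofReal_integral_eq_lintegral_ofReal hintB (ae_of_all _ fun x => by positivity)]
      refine lintegral_congr fun x => ?_
      rw [ENNReal.ofReal_pow (norm_nonneg _), ofReal_norm]
    have h2a : ∫⁻ x in B, ‖u s x‖ₑ ^ 2 ≤ ENNReal.ofReal a := by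
      rw [e2]; exact ENNReal.ofReal_le_ofReal (ha s ⟨hs.1.le, hs.2.trans ht₁.2⟩)
    have h2E : ∫⁻ x, ‖u s x‖ₑ ^ 2 ≤ ENNReal.ofReal E := by
      have h := hLH.lintegral_enorm_sq_le hν (t := s) ⟨hsS.1, hsS.2.le⟩
      have hKE : 2 * VectorCalculus.kineticEnergy (u 0) = E := by
        rw [hEdef, VectorCalculus.kineticEnergy]; ring
      rwa [hKE] at h
    have hsl' := slice_le (u s) hC1 hmem (q s) hst.2.1.1 hst.2.2 x₀ R
    rw [e1]
    calc ∫⁻ x in B, ‖q s x‖ₑ * ‖u s x‖ₑ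
        ≤ (CS : ℝ≥0∞) * (∫⁻ x, ‖u s x‖ₑ ^ 2) ^ (1 / 2 : ℝ) * (∫⁻ x in B, ‖u s x‖ₑ ^ 2) ^ (4⁻¹ : ℝ) *
            (((K : ℝ≥0∞) ^ (3 / 2 : ℝ)) * F s ^ (3 / 4 : ℝ)) := hsl'
      _ ≤ (CS : ℝ≥0∞) * ENNReal.ofReal E ^ (1 / 2 : ℝ) * ENNReal.ofReal a ^ (4⁻¹ : ℝ) *
            (((K : ℝ≥0∞) ^ (3 / 2 : ℝ)) *
              (ENNReal.ofReal (3 / 4 * κ) * F s + ENNReal.ofReal (4⁻¹ * κ⁻¹ ^ 3))) := by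
          gcongr
          all_goals first
            | exact h2E
            | exact h2a
            | exact CubicFlux.rpow_threeQuarters_le_young _ hκ
      _ = Mₑ * (ENNReal.ofReal (3 / 4 * κ) * F s + ENNReal.ofReal (4⁻¹ * κ⁻¹ ^ 3)) := by
          rw [hMₑ]; ring
  -- integrate over `I`
  have hMtop : Mₑ ≠ ⊤ := by
    rw [hMₑ]
    refine ENNReal.mul_ne_top (ENNReal.mul_ne_top (ENNReal.mul_ne_top ENNReal.coe_ne_top
      (ENNReal.rpow_ne_top_of_nonneg (by norm_num) ENNReal.ofReal_ne_top))
      (ENNReal.rpow_ne_top_of_nonneg (by norm_num) ENNReal.ofReal_ne_top))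
      (ENNReal.rpow_ne_top_of_nonneg (by norm_num) ENNReal.coe_ne_top)
  have hvolI : volume I ≤ ENNReal.ofReal τ := by
    rw [hIdef, Real.volume_Ioo]
    exact ENNReal.ofReal_le_ofReal (by linarith [ht₁.2])
  have hFI : ∫⁻ s in I, F s ≤ ENNReal.ofReal G :=
    (lintegral_mono_set (Ioo_subset_Ioo le_rfl ht₁.2.le)).trans hGw
  have hmain : ∫⁻ s in I, ENNReal.ofReal (cq s) ≤
      Mₑ * (ENNReal.ofReal (3 / 4 * κ) * ENNReal.ofReal G +
        ENNReal.ofReal (4⁻¹ * κ⁻¹ ^ 3) * ENNReal.ofReal τ) := by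
    calc ∫⁻ s in I, ENNReal.ofReal (cq s)
        ≤ ∫⁻ s in I, Mₑ * (ENNReal.ofReal (3 / 4 * κ) * F s + ENNReal.ofReal (4⁻¹ * κ⁻¹ ^ 3)) :=
          lintegral_mono_ae hslice
      _ = Mₑ * (ENNReal.ofReal (3 / 4 * κ) * (∫⁻ s in I, F s) +
            ENNReal.ofReal (4⁻¹ * κ⁻¹ ^ 3) * volume I) := by
          rw [lintegral_const_mul' _ _ hMtop, lintegral_add_right' _ aemeasurable_const,
            lintegral_const_mul' _ _ ENNReal.ofReal_ne_top, setLIntegral_const]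
      _ ≤ _ := by gcongr
  -- back to `ℝ`
  set M : ℝ := (CS : ℝ) * (K : ℝ) ^ (3 / 2 : ℝ) * Real.sqrt E * a ^ (1 / 4 : ℝ) with hMdef
  have hM0 : 0 ≤ M := by positivity
  have hMe : Mₑ = ENNReal.ofReal M := by
    rw [hMₑ, hMdef, ← ENNReal.ofReal_coe_nnreal, ← ENNReal.ofReal_coe_nnreal,
      ENNReal.ofReal_rpow_of_nonneg K.coe_nonneg (by norm_num),
      ENNReal.ofReal_rpow_of_nonneg hE0 (by norm_num), ENNReal.ofReal_rpow_of_nonneg ha0 (by norm_num),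
      Real.sqrt_eq_rpow, show (4⁻¹ : ℝ) = 1 / 4 by norm_num,
      ← ENNReal.ofReal_mul (by positivity), ← ENNReal.ofReal_mul (by positivity),
      ← ENNReal.ofReal_mul (by positivity)]
    congr 1
    ring
  have hRHS : Mₑ * (ENNReal.ofReal (3 / 4 * κ) * ENNReal.ofReal G +
        ENNReal.ofReal (4⁻¹ * κ⁻¹ ^ 3) * ENNReal.ofReal τ) =
      ENNReal.ofReal (M * (3 / 4 * κ * G + 4⁻¹ * κ⁻¹ ^ 3 * τ)) := by
    rw [hMe, ← ENNReal.ofReal_mul (by positivity), ← ENNReal.ofReal_mul (by positivity),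
      ← ENNReal.ofReal_add (by positivity) (by positivity), ← ENNReal.ofReal_mul hM0]
  have hbound : 0 ≤ M * (3 / 4 * κ * G + 4⁻¹ * κ⁻¹ ^ 3 * τ) := by positivity
  have hfin : ENNReal.ofReal (∫ s in I, cq s) ≤
      ENNReal.ofReal (M * (3 / 4 * κ * G + 4⁻¹ * κ⁻¹ ^ 3 * τ)) := by
    rw [ofReal_integral_eq_lintegral_ofReal hcqI (ae_of_all _ fun s => hcqnn s), ← hRHS]
    exact hmain
  rw [heq]
  exact (ENNReal.ofReal_le_ofReal_iff hbound).1 hfin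

/-- ★★ **THE PRESSURE FLUX BUDGET (optimised form).** Same frame, hypotheses and gauge data as
`pressureFlux_le_young`; then `|p − c(t)||u|` is integrable on `(T−τ,t₁) × B(x₀,R)` and
`∬_{(T−τ,t₁)×B(x₀,R)}|p − c(t)||u| ≤ C_{3/2} · K^{3/2} · √(∫|u₀|²) · a^{1/4} · τ^{1/4} · G^{3/4}`.
This discharges the last hypothesis number `mpu` of `LocalEnergyBudget.scar_le_of_pressureBudget`
from frame data (`G ≤ ‖u₀‖₂√H/ν` by the landed `CubicFlux.windowEnstrophy_le_of_modulus`).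
[cite: CaffarelliKohnNirenberg1982, §2 (2.4)] -/
theorem pressureFlux_le {ν T : ℝ} (hν : 0 ≤ ν)
    {u : ℝ → EuclideanSpace ℝ (Fin 3) → EuclideanSpace ℝ (Fin 3)}
    {p : ℝ → EuclideanSpace ℝ (Fin 3) → ℝ}
    (hcl : IsClassicalNSSolutionOn (Set.Ico 0 T) ν 0 u p) (hLH : IsLerayHopfOn T ν 0 (u 0) u)
    (x₀ : EuclideanSpace ℝ (Fin 3)) (R : ℝ) {τ t₁ a G : ℝ} (hτT : τ < T)
    (ht₁ : t₁ ∈ Ioo (T - τ) T)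
    (ha : ∀ s ∈ Ico (T - τ) T, ∫ x in ball x₀ R, ‖u s x‖ ^ 2 ≤ a) (hG : 0 ≤ G)
    (hGw : ∫⁻ t in Ioo (T - τ) T, ∫⁻ x, ENNReal.ofReal (frobeniusNormSq (fderiv ℝ (u t) x)) ≤
      ENNReal.ofReal G)
    {q : ℝ → EuclideanSpace ℝ (Fin 3) → ℝ} {c : ℝ → ℝ}
    (hq32 : MemLp (uncurry q) (3 / 2 : ℝ≥0∞)
      (volume.restrict (Ioo 0 T ×ˢ (univ : Set (EuclideanSpace ℝ (Fin 3))))))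
    (hpq : ∀ᵐ z ∂(volume.restrict (Ioo 0 T ×ˢ (univ : Set (EuclideanSpace ℝ (Fin 3))))),
      p z.1 z.2 - c z.1 = q z.1 z.2)
    (hsl : ∀ᵐ t ∂(volume.restrict (Ioo 0 T)),
      (∀ᵐ x ∂(volume : Measure (EuclideanSpace ℝ (Fin 3))), p t x - c t = q t x) ∧
        MemLp (q t) (3 / 2 : ℝ≥0∞) volume ∧
        eLpNorm (q t) (3 / 2 : ℝ≥0∞) volume ≤ steinConstThreeHalves * eLpNorm (u t) 3 volume ^ 2) :
    IntegrableOn (fun z : ℝ × EuclideanSpace ℝ (Fin 3) => |p z.1 z.2 - c z.1| * ‖u z.1 z.2‖)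
        (Ioo (T - τ) t₁ ×ˢ ball x₀ R) ∧
      ∫ z in Ioo (T - τ) t₁ ×ˢ ball x₀ R, |p z.1 z.2 - c z.1| * ‖u z.1 z.2‖ ≤
        (steinConstThreeHalves : ℝ) *
          ((SNormLESNormFDerivOfEqConst (EuclideanSpace ℝ (Fin 3))
            (volume : Measure (EuclideanSpace ℝ (Fin 3))) 2 : ℝ≥0) : ℝ) ^ (3 / 2 : ℝ) *
          Real.sqrt (∫ x, ‖u 0 x‖ ^ 2) * a ^ (1 / 4 : ℝ) *
            (τ ^ (1 / 4 : ℝ) * G ^ (3 / 4 : ℝ)) := by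
  have hτ : 0 < τ := by linarith [ht₁.1, ht₁.2]
  have ha0 : 0 ≤ a :=
    (integral_nonneg fun x => by positivity).trans (ha (T - τ) ⟨le_rfl, by linarith⟩)
  have h1 := pressureFlux_le_young hν hcl hLH x₀ R hτT ht₁ ha hG hGw one_pos hq32 hpq hsl
  refine ⟨h1.1, young_optimise (by positivity) hτ hG fun κ hκ => ?_⟩
  exact (pressureFlux_le_young hν hcl hLH x₀ R hτT ht₁ ha hG hGw hκ hq32 hpq hsl).2

end PressureFlux

end Summit.NavierStokesRegularity.NavierStokesRegularity.Theorems

end
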